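import Summits.QuantumFields.YangMills.Theorems.PoincareLipschitzMeanDeviationOfShallowSecondMoment
import Summits.QuantumFields.YangMills.Theorems.UnitScaleGibbsActionDerivativeSlotCalculus
import Summits.QuantumFields.YangMills.Theorems.GrossTransferStubLinTest
import Summits.QuantumFields.YangMills.Theorems.GrossTransferStubsRestampV32
import Summits.QuantumFields.YangMills.Theorems.GrossTransferStubsRestampV33
import Summits.QuantumFields.YangMills.Theorems.UnitScaleGibbsBoxPeierlsPolynomial
import Literature.MathematicalPhysics.QuantumFieldTheory.Balaban1983to89.T4AxialGaugeSmallField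
import HarnessLib

/-!
# LINE 28 «GrossTransfer» (skeleton v3.3 `Cruxes/HistoryTailL/Lines/gross_transfer.lean`, sha16 27a981090dd87131, ideator ym-r3-idea-2 g17 over
# w2-19936 g15's re-line) — THE SIX LANDED MECHANISM STUBS COMPOSED IN THE TREE: «ShallowFluxSecondMomentL» and
# `RevelationMartingale.MeanDeviationShallowL` (stmt-QuantumFields-23133) WITHOUT HYPOTHESES; `MeanDeviationL` (stmt-QuantumFields-23083) ⟸ ITS DEEP HALF ALONE

Cell `ym3-torus` (YM ladder rung R3 = continuum SU(2) Yang–Mills on T³ — a RUNG, NOT d = 4, NOT infinite volume, NOT a mass gap, NOT Clay).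
Hand `leafhand-qf-poincarelipschitz-1` g0 (items 23532 ∕ 23083).  THEOREMS ONLY (0 `def`, 0 `sorry`).

WHAT THIS FILE DOES.  All six mechanism stubs of LINE 28 are tree theorems with the registered texts —
✓p757896 `GrossTransferStubLinTest.stub_linTest` (w2-19936 g16 over px13 g12's pointwise package), ✓p751141 `GrossTransferStubsRestampV33.stub_condSD` ∕
`.stub_hessOnEvent`, ✓p738745 `UnitScaleGibbsBoxPeierlsPolynomial.stub_peierls0`, ✓p749481 `GrossTransferStubsRestampV32.stub_thinRect` ∕ `.stub_orient` — and the
skeleton's composition `shallowFluxSecondMomentL_of` is sorry-free but lives in a Cruxes module (not importable under `Theorems/`).  This file PORTS that composition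
token for token (§1, attribution below) and plugs the six landed theorems BY NAME (§2):
* ★★★ `shallowFluxSecondMomentL` — the UV-window second moment «ShallowFluxSecondMomentL» (`∀ L ∃ N₁ C γ₁ ∀ F γ K j, 1 ≤ j → N₁·j ≤ K → ∫ dist₁(Ū^j(∂a))² dμ_K ≤ C·γL^{−(K−j)}`),
  HYPOTHESIS-FREE;
* ★★★ `meanDeviationShallowL : Theses.RevelationMartingale.MeanDeviationShallowL` — item stmt-QuantumFields-23133 BY NAME, HYPOTHESIS-FREE (via ✓p733394
  `meanDeviationShallowL_of_shallowSecondMoment`);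
* ★★ `meanDeviationL_of_deep (hDeep : MeanDeviationDeepL) : Theses.RevelationMartingale.MeanDeviationL` and its `Theses.PoincareLipschitz` spelling
  `meanDeviationL'_of_deep` — stmt-QuantumFields-23083 ⟸ its registered residual `stub_meanDeviationDeep` (= stmt-QuantumFields-23134) ALONE.

HONEST SCOPE.  `MeanDeviationDeepL` (23134; first-moment UV stability of block-averaged plaquettes at deep levels — Bałaban's induction, organ-adjacent) is NOT
proved and is the only open row of 23083; `HistoryTailL` (19936), the rung R3, any summit statement are NOT proved; the Yang–Mills mass gap is NOT proved.
[§1 adapted verbatim from `Cruxes/HistoryTailL/Lines/gross_transfer.lean` v3.3 §2 (pen w2-19936 g15 ∕ ideator ym-r3-idea-2 g17), namespace re-homed.]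

References: [GrossCMP1983] L. Gross, CMP 92 (1983) 137–162, Thm 2.2; [Balaban1985UV3] T. Bałaban, CMP 102 (1985) 255–275, (7) p.257, (71) p.273;
[Balaban1985Averaging] CMP 98 (1985) 17–51, (19) p.21; Fröhlich–Israel–Lieb–Simon, CMP 62 (1978) §4.
-/

set_option autoImplicit false

open MeasureTheory
open scoped BigOperators Matrix.Norms.Frobenius
open Literature.MathematicalPhysics.QuantumFieldTheory.Balaban1983to89
open Literature.MathematicalPhysics.QuantumFieldTheory.Balaban1983to89.T3ContinuumYM3Torus
open Literature.MathematicalPhysics.QuantumFieldTheory.Balaban1983to89.T3UnitScaleTilt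
open Literature.MathematicalPhysics.QuantumFieldTheory.Balaban1983to89.T3UnitLawDensityEML (ℰp)
open Literature.MathematicalPhysics.QuantumFieldTheory.Balaban1983to89.T4AxialGaugeSmallField (axialGauge boxPlaqs boxBonds castSite)
open Literature.MathematicalPhysics.QuantumFieldTheory.Balaban1983to89.B7Prop1Explicit (e)
open Literature.MathematicalPhysics.QuantumFieldTheory.Balaban1983to89.B8Lemma1NonAbelian (lowPart)
open Literature.MathematicalPhysics.QuantumLattice (fundamentalRep)
open Summit.QuantumFields.YangMills.Theorems.UnitScaleGibbsActionDerivativeSlotCalculus (actionDeriv actionDeriv₂ slotBond)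
open Summit.QuantumFields.YangMills.Theorems.PoincareLipschitzMeanDeviationOfShallowSecondMoment
  (meanDeviationShallowL_of_shallowSecondMoment meanDeviationL_of_shallowSecondMoment_deep meanDeviationL_of_shallowSecondMoment_deep')


namespace Summit.QuantumFields.YangMills.Theorems.GrossTransferShallowSecondMoment

/-! ## §1 The composition (ported verbatim from the skeleton): six stub TEXTS ⇒ «ShallowFluxSecondMomentL» -/

set_option maxHeartbeats 1600000 in
-- hb: the registered skeleton's own budget for this very proof (gross_transfer.lean v3.3 §2, ported verbatim); measured on the farm: FAILS at 400k (linarith, l.≈231) and at 800k (isDefEq, l.≈297), passes at 1.6M in ≈ 80 s — six-term window bookkeeping in one `calc`.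
/-- ★★★ **COMPOSITION v3.1 (sorry-free): the six stubs ⇒ the UV-window second moment «ShallowFluxSecondMomentL»** (ws-sha16 40ab093fc3808c90, the `hSh`
binder of ✓`PoincareLipschitzMeanDeviationOfShallowSecondMoment`).  Window arithmetic in `y = (γL^{−K})^{1∕16}` (`θ_K = y⁶`, `γL^{−K} = y¹⁶`;
LOG-FREE since v3.2: the former log factor is the constant `ℓ := 1`, the absorption rows `ℓ·y ≤ 17`, `ℓ²θ_K ≤ 289y⁴`, `ℓ³x^{c+5} ≤ 4913x^{c+4}` kept at `ℓ = 1`):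
`N₁ = max N (12c + 16)`, Peierls order `M = c + 5`, `γ₁ = min`; the six terms (curl energy · β⁻¹; small-field Hessian corrections `L^{3cj}θ_K ≤ 289y⁴`-window;
Hessian × tail; the weighted thin-rectangle row `Σ_b ω_b·C₅nβ_K⁻¹ ≤ C₁C₅·L^jβ_K⁻¹` by the folded floor `n·Σω ≤ C₁·L^j`;
linearisation remainder; `4·tail`) are each `≤ const·γL^{−(K−j)}`. [cite: GrossCMP1983, Thm 2.2] -/
theorem shallowFluxSecondMomentL_of
    (h1 : ∀ (L : ℕ), ∃ (C : ℝ) (c N : ℕ), 0 ≤ C ∧ 0 < N ∧ ∃ γ₁ : ℝ, 0 < γ₁ ∧ γ₁ ≤ 1 ∧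
          ∀ (F : T3Family) (γ : ℝ), F.L = L → 0 < γ → γ ≤ γ₁ → ∀ (K j : ℕ), 1 ≤ j → N * j ≤ K →
            ∀ a : Plaq (F.P K) j, a.μ.val = 1 → a.ν.val = 2 →
              ∃ (lo hi : Fin (F.P K).d → ℤ) (n : ℕ) (u : Fin 3 → PBond (F.P K) 0 → Matrix (Fin 2) (Fin 2) ℂ)
                (ω : PBond (F.P K) 0 → ℝ),
                (∀ κ, lo κ ≤ hi κ ∧ hi κ ≤ lo κ + n) ∧ 2 * n + 6 ≤ (F.P K).sitesPerDir 0 ∧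
                (∀ α b, star (u α b) = -(u α b) ∧ (u α b).trace = 0) ∧
                (∀ α b, u α b ≠ 0 → ∃ x : Fin (F.P K).d → ℤ,
                    lo + 1 ≤ x ∧ x + e b.dir + 1 ≤ hi ∧ b.src = castSite x ∧ lowPart b.dir (x - lo) ≠ 0) ∧
                (n : ℝ) ≤ C * (L : ℝ) ^ (c * j) ∧
                (∀ α, ∑ p : Plaq (F.P K) 0, ‖u α (slotBond p 0) + u α (slotBond p 1) - u α (slotBond p 2) - u α (slotBond p 3)‖ ^ 2 ≤ C * (L : ℝ) ^ j) ∧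
                (∀ α, ∑ b : PBond (F.P K) 0, ‖u α b‖ ^ 2 ≤ C * (L : ℝ) ^ (c * j)) ∧
                (∀ b, 0 ≤ ω b) ∧ (∀ b, ω b ≠ 0 → b ∈ (boxBonds lo hi : Set (PBond (F.P K) 0))) ∧
                (n : ℝ) * ∑ b : PBond (F.P K) 0, ω b ≤ C * (L : ℝ) ^ j ∧
                ∫ U, (GaugeGroup.dist1 (GaugeField.plaqHol
                    (Averaging.iter (fun i' => BlockAveraging.blockAvg (P := F.P K) (j := i') ℰp) j U) a)) ^ 2 ∂(gibbsK F ℰp γ K)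
                  ≤ C * ∑ α, ∫ U, (actionDeriv (fundamentalRep (Fin 2)) (u α) (GaugeField.gaugeAct (axialGauge U lo hi) U)) ^ 2 ∂(gibbsK F ℰp γ K)
                    + ∑ b : PBond (F.P K) 0, ω b *
                        ∫ U, (GaugeGroup.dist1 (GaugeField.gaugeAct (axialGauge U lo hi) U b)) ^ 2 ∂(gibbsK F ℰp γ K)
                    + C * (γ * ((L : ℝ)⁻¹) ^ (K - j))
                    + 4 * (gibbsK F ℰp γ K).real {U | ¬ PlaqSmallOn (boxPlaqs lo hi) ((γ * ((L : ℝ)⁻¹) ^ K) ^ ((3 : ℝ) / 8)) U})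
    (h2 : ∀ (F : T3Family) (γ : ℝ), 0 ≤ γ → ∀ (K : ℕ) (lo hi : Fin (F.P K).d → ℤ) (n : ℕ)
            (u : PBond (F.P K) 0 → Matrix (Fin 2) (Fin 2) ℂ),
            (∀ κ, lo κ ≤ hi κ ∧ hi κ ≤ lo κ + n) → n < (F.P K).sitesPerDir 0 →
            (∀ b, star (u b) = -(u b) ∧ (u b).trace = 0) →
            (∀ b, u b ≠ 0 → ∃ x : Fin (F.P K).d → ℤ,
                lo + 1 ≤ x ∧ x + e b.dir + 1 ≤ hi ∧ b.src = castSite x ∧ lowPart b.dir (x - lo) ≠ 0) →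
            (F.scheme ℰp γ).β K *
                ∫ U, (actionDeriv (fundamentalRep (Fin 2)) u (GaugeField.gaugeAct (axialGauge U lo hi) U)) ^ 2 ∂(gibbsK F ℰp γ K)
              = ∫ U, actionDeriv₂ (fundamentalRep (Fin 2)) u (GaugeField.gaugeAct (axialGauge U lo hi) U) ∂(gibbsK F ℰp γ K))
    (h3 : ∃ C : ℝ, 0 ≤ C ∧ ∀ (F : T3Family) (γ : ℝ), 0 ≤ γ → ∀ (K : ℕ) (lo hi : Fin (F.P K).d → ℤ) (n : ℕ)
            (u : PBond (F.P K) 0 → Matrix (Fin 2) (Fin 2) ℂ),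
            (∀ κ, lo κ ≤ hi κ ∧ hi κ ≤ lo κ + n) → n < (F.P K).sitesPerDir 0 →
            (∀ b, star (u b) = -(u b) ∧ (u b).trace = 0) →
            (∀ b, u b ≠ 0 → ∃ x : Fin (F.P K).d → ℤ,
                lo + 1 ≤ x ∧ x + e b.dir + 1 ≤ hi ∧ b.src = castSite x ∧ lowPart b.dir (x - lo) ≠ 0) →
            ∀ θ : ℝ, 0 < θ →
              ∫ U, actionDeriv₂ (fundamentalRep (Fin 2)) u (GaugeField.gaugeAct (axialGauge U lo hi) U) ∂(gibbsK F ℰp γ K)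
                ≤ C * ∑ p : Plaq (F.P K) 0, ‖u (slotBond p 0) + u (slotBond p 1) - u (slotBond p 2) - u (slotBond p 3)‖ ^ 2
                  + C * ((n : ℝ) + 1) ^ 2 * (θ + θ ^ 2) * ∑ b : PBond (F.P K) 0, ‖u b‖ ^ 2
                  + C * (∑ b : PBond (F.P K) 0, ‖u b‖ ^ 2)
                      * (gibbsK F ℰp γ K).real {U | ¬ PlaqSmallOn (boxPlaqs lo hi) θ U})
    (h4 : ∀ (L M : ℕ), ∃ C : ℝ, 0 ≤ C ∧ ∃ γ₁ : ℝ, 0 < γ₁ ∧ γ₁ ≤ 1 ∧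
          ∀ (F : T3Family) (γ : ℝ), F.L = L → 0 < γ → γ ≤ γ₁ → ∀ (K : ℕ) (lo hi : Fin (F.P K).d → ℤ) (n : ℕ),
            (∀ κ, lo κ ≤ hi κ ∧ hi κ ≤ lo κ + n) → n < (F.P K).sitesPerDir 0 →
            (gibbsK F ℰp γ K).real {U | ¬ PlaqSmallOn (boxPlaqs lo hi) ((γ * ((L : ℝ)⁻¹) ^ K) ^ ((3 : ℝ) / 8)) U}
              ≤ C * ((n : ℝ) + 1) ^ 3 * (γ * ((L : ℝ)⁻¹) ^ K) ^ M)
    (h5 : ∀ (L : ℕ), ∃ C : ℝ, 0 ≤ C ∧ ∃ γ₁ : ℝ, 0 < γ₁ ∧ γ₁ ≤ 1 ∧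
          ∀ (F : T3Family) (γ : ℝ), F.L = L → 0 < γ → γ ≤ γ₁ → ∀ (K : ℕ) (lo hi : Fin (F.P K).d → ℤ) (n : ℕ),
            (∀ κ, lo κ ≤ hi κ ∧ hi κ ≤ lo κ + n) → 2 * n + 6 ≤ (F.P K).sitesPerDir 0 →
            ∀ b : PBond (F.P K) 0, b ∈ (boxBonds lo hi : Set (PBond (F.P K) 0)) →
              ∫ U, (GaugeGroup.dist1 (GaugeField.gaugeAct (axialGauge U lo hi) U b)) ^ 2 ∂(gibbsK F ℰp γ K)
                ≤ C * n * (γ * ((L : ℝ)⁻¹) ^ K))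
    (h6 : ∀ (F : T3Family) (γ : ℝ), 0 ≤ γ → ∀ (K j : ℕ) (p q : Plaq (F.P K) j) (φ : ℝ → ℝ),
          ∫ U, φ (GaugeGroup.dist1 (GaugeField.plaqHol (Averaging.iter (fun i' => BlockAveraging.blockAvg (P := F.P K) (j := i') ℰp) j U) p))
              ∂(gibbsK F ℰp γ K) =
            ∫ U, φ (GaugeGroup.dist1 (GaugeField.plaqHol (Averaging.iter (fun i' => BlockAveraging.blockAvg (P := F.P K) (j := i') ℰp) j U) q))
              ∂(gibbsK F ℰp γ K)) :
    ∀ (L : ℕ), ∃ N₁ : ℕ, 0 < N₁ ∧ ∃ C : ℝ, 0 ≤ C ∧ ∃ γ₁ : ℝ, 0 < γ₁ ∧ γ₁ ≤ 1 ∧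
          ∀ (F : T3Family) (γ : ℝ), F.L = L → 0 < γ → γ ≤ γ₁ → ∀ (K j : ℕ), 1 ≤ j → N₁ * j ≤ K →
            ∀ a : Plaq (F.P K) j,
              ∫ U, (GaugeGroup.dist1 (GaugeField.plaqHol
                  (Averaging.iter (fun i' => BlockAveraging.blockAvg (P := F.P K) (j := i') ℰp) j U) a)) ^ 2 ∂(gibbsK F ℰp γ K)
                ≤ C * (γ * ((F.L : ℝ)⁻¹) ^ (K - j)) := by
  classical
  intro L
  obtain ⟨C₁, c, N, hC₁, hN, γa, hγa, hγa1, H1⟩ := h1 L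
  obtain ⟨C₃, hC₃, H3⟩ := h3
  obtain ⟨C₄, hC₄, γb, hγb, hγb1, H4⟩ := h4 L (c + 5)
  obtain ⟨C₅, hC₅, γc, hγc, hγc1, H5⟩ := h5 L
  -- the Hessian-side constant (per colour component) and the total constant
  set KH : ℝ := C₃ * C₁ + C₃ * (578 * C₁ * (C₁ + 1) ^ 2) + C₃ * (4913 * C₁ * C₄ * (C₁ + 1) ^ 3) with hKH
  refine ⟨max N (12 * c + 16), Nat.lt_of_lt_of_le hN (le_max_left _ _),
    3 * C₁ * KH + C₅ * C₁ + C₁ + 4 * (4913 * C₄ * (C₁ + 1) ^ 3), by positivity,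
    min γa (min γb γc), lt_min hγa (lt_min hγb hγc), (min_le_left _ _).trans hγa1, ?_⟩
  intro F γ hFL hγ hγle K j hj hNj a
  subst hFL
  have hγa' : γ ≤ γa := hγle.trans (min_le_left _ _)
  have hγb' : γ ≤ γb := hγle.trans ((min_le_right _ _).trans (min_le_left _ _))
  have hγc' : γ ≤ γc := hγle.trans ((min_le_right _ _).trans (min_le_right _ _))
  have hγ1 : γ ≤ 1 := hγa'.trans hγa1
  have hNj' : N * j ≤ K := le_trans (Nat.mul_le_mul_right j (le_max_left _ _)) hNj
  have hcj : (12 * c + 16) * j ≤ K := le_trans (Nat.mul_le_mul_right j (le_max_right N _)) hNj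
  have hjK : j ≤ K := le_trans (Nat.le_mul_of_pos_left j hN) hNj'
  -- the reference plaquette of orientation `(1,2)` at `a`'s corner, its box, test fields, weights and integrated linearisation
  have hd3 : (F.P K).d = 3 := rfl
  let q : Plaq (F.P K) j := ⟨a.src, ⟨1, by rw [hd3]; norm_num⟩, ⟨2, by rw [hd3]; norm_num⟩, Fin.mk_lt_mk.mpr (by norm_num)⟩
  obtain ⟨lo, hi, n, u, ω, hbox, hn6, hsu, hsupp, hnC, hD, hS, hω0, hωsupp, hfloor, hlin⟩ := H1 F γ rfl hγ hγa' K j hj hNj' q rfl rfl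
  have horient : ∫ U, (GaugeGroup.dist1 (GaugeField.plaqHol
        (Averaging.iter (fun i' => BlockAveraging.blockAvg (P := F.P K) (j := i') ℰp) j U) a)) ^ 2 ∂(gibbsK F ℰp γ K) =
      ∫ U, (GaugeGroup.dist1 (GaugeField.plaqHol
        (Averaging.iter (fun i' => BlockAveraging.blockAvg (P := F.P K) (j := i') ℰp) j U) q)) ^ 2 ∂(gibbsK F ℰp γ K) :=
    h6 F γ hγ.le K j a q (fun t => t ^ 2)
  have hn : n < (F.P K).sitesPerDir 0 := by omega
  -- basic real facts
  have hL1 : (1 : ℝ) ≤ (F.L : ℝ) := by exact_mod_cast F.hL.2.le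
  have hL0 : (0 : ℝ) < (F.L : ℝ) := by linarith
  have hX0 : 0 < (γ * ((F.L : ℝ)⁻¹) ^ K) := by positivity
  have hXle : (γ * ((F.L : ℝ)⁻¹) ^ K) ≤ ((F.L : ℝ)⁻¹) ^ K := by
    calc (γ * ((F.L : ℝ)⁻¹) ^ K) ≤ 1 * ((F.L : ℝ)⁻¹) ^ K := by gcongr
    _ = ((F.L : ℝ)⁻¹) ^ K := one_mul _
  have hX1 : (γ * ((F.L : ℝ)⁻¹) ^ K) ≤ 1 := hXle.trans (pow_le_one₀ (by positivity) (inv_le_one_of_one_le₀ hL1))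
  -- the sixteenth root `y` of `x = γL^{-K}`: `θ_K = y⁶`, `x = y¹⁶`; log-free since v3.2: `ℓ := 1`, so `ℓ·y ≤ 17` trivially
  set x : ℝ := γ * ((F.L : ℝ)⁻¹) ^ K with hx
  set y : ℝ := x ^ ((1 : ℝ) / 16) with hy
  set ℓ : ℝ := (1 : ℝ) with hℓ
  have hy0 : 0 < y := Real.rpow_pos_of_pos hX0 _
  have hy1 : y ≤ 1 := Real.rpow_le_one hX0.le hX1 (by norm_num)
  have hy16 : y ^ 16 = x := by
    rw [hy, ← Real.rpow_natCast _ 16, ← Real.rpow_mul hX0.le]; norm_num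
  have hθy : x ^ ((3 : ℝ) / 8) = y ^ 6 := by
    rw [hy, ← Real.rpow_natCast _ 6, ← Real.rpow_mul hX0.le]; norm_num
  have hℓ1 : 1 ≤ ℓ := le_rfl
  have hℓ0 : 0 ≤ ℓ := zero_le_one.trans hℓ1
  have hℓy : ℓ * y ≤ 17 := by rw [hℓ, one_mul]; linarith
  have hT0 : 0 < x ^ ((3 : ℝ) / 8) := Real.rpow_pos_of_pos hX0 _
  have hT1 : x ^ ((3 : ℝ) / 8) ≤ 1 := Real.rpow_le_one hX0.le hX1 (by norm_num)
  have hLj1 : (1 : ℝ) ≤ (F.L : ℝ) ^ j := one_le_pow₀ hL1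
  have hLcj1 : (1 : ℝ) ≤ (F.L : ℝ) ^ (c * j) := one_le_pow₀ hL1
  have hn1 : (n : ℝ) + 1 ≤ (C₁ + 1) * (F.L : ℝ) ^ (c * j) * ℓ := by
    have h1 : (1 : ℝ) ≤ (F.L : ℝ) ^ (c * j) * ℓ := by nlinarith
    have h2 : (n : ℝ) ≤ C₁ * (F.L : ℝ) ^ (c * j) * ℓ := by rw [hℓ, mul_one]; exact hnC
    nlinarith
  have hn0 : (0 : ℝ) ≤ (n : ℝ) + 1 := by positivity
  -- `β_K = x⁻¹` and the target unit `γ·L^(-(K-j)) = x·L^j`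
  have hβ : (F.scheme ℰp γ).β K = x⁻¹ := by
    simp only [hx, T3Family.scheme, Params.eps, T3Family.P, Literature.MathematicalPhysics.QuantumFieldTheory.Balaban1985CMP102.Setting.params3]
  have hxLj : γ * ((F.L : ℝ)⁻¹) ^ (K - j) = x * (F.L : ℝ) ^ j := by
    rw [hx, inv_pow, inv_pow, pow_sub₀ _ hL0.ne' hjK, mul_inv, inv_inv]; ring
  -- generic window lemma: `L^a · x^b ≤ 1` when `a ≤ K·b`
  have hwin : ∀ a b : ℕ, a ≤ K * b → (F.L : ℝ) ^ a * x ^ b ≤ 1 := by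
    intro a b hab
    calc (F.L : ℝ) ^ a * x ^ b ≤ (F.L : ℝ) ^ a * (((F.L : ℝ)⁻¹) ^ K) ^ b := by gcongr
    _ = (F.L : ℝ) ^ a / (F.L : ℝ) ^ (K * b) := by rw [← pow_mul, inv_pow, div_eq_mul_inv]
    _ ≤ 1 := by rw [div_le_one (by positivity)]; exact pow_le_pow_right₀ hL1 hab
  -- (W1) the Hessian window `L^{3cj}·y⁴ ≤ 1` (⇔ `L^{12cj}·x ≤ 1`, `12cj ≤ K`)
  have hW1 : (F.L : ℝ) ^ (3 * (c * j)) * y ^ 4 ≤ 1 := by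
    have h12 : 12 * (c * j) ≤ K * 1 := by
      have : (12 * c + 16) * j = 12 * (c * j) + 16 * j := by ring
      omega
    have hz0 : 0 ≤ (F.L : ℝ) ^ (3 * (c * j)) * y ^ 4 := by positivity
    rw [← pow_le_one_iff_of_nonneg hz0 (by norm_num : (4 : ℕ) ≠ 0)]
    rw [mul_pow, ← pow_mul, ← pow_mul, show 3 * (c * j) * 4 = 12 * (c * j) by ring, show (4 : ℕ) * 4 = 16 by norm_num, hy16,
      ← pow_one x]
    exact hwin _ _ h12
  -- (W2), (W3) the Peierls windows at order `M = c + 5`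
  have hW2 : (F.L : ℝ) ^ (4 * (c * j)) * x ^ (c + 3) ≤ 1 := by
    refine hwin _ _ ?_
    have := Nat.mul_le_mul (show 4 * c ≤ 4 * (c + 3) by omega) hjK
    nlinarith
  have hW3 : (F.L : ℝ) ^ (3 * (c * j)) * x ^ (c + 3) ≤ 1 := by
    refine hwin _ _ ?_
    have := Nat.mul_le_mul (show 3 * c ≤ 3 * (c + 3) by omega) hjK
    nlinarith
  -- the large-field tail (stub_peierls0 at order `M = c + 5`)
  have hm : (gibbsK F ℰp γ K).real {U | ¬ PlaqSmallOn (boxPlaqs lo hi) (x ^ ((3 : ℝ) / 8)) U} ≤ C₄ * ((n : ℝ) + 1) ^ 3 * x ^ (c + 5) :=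
    H4 F γ rfl hγ hγb' K lo hi n hbox hn
  have hm0 : 0 ≤ (gibbsK F ℰp γ K).real {U | ¬ PlaqSmallOn (boxPlaqs lo hi) (x ^ ((3 : ℝ) / 8)) U} := measureReal_nonneg
  -- the absorptions at `ℓ = 1` (formerly the log absorptions): `ℓ²·θ ≤ 289·y⁴`, `ℓ³·x^{c+5} ≤ 4913·x^{c+4}`
  have hA2 : ℓ ^ 2 * x ^ ((3 : ℝ) / 8) ≤ 289 * y ^ 4 := by
    rw [hθy]
    have : ℓ ^ 2 * y ^ 6 = (ℓ * y) ^ 2 * y ^ 4 := by ring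
    rw [this]
    have h := pow_le_pow_left₀ (by positivity) hℓy 2
    nlinarith [pow_nonneg hy0.le 4]
  have hA3 : ℓ ^ 3 * x ^ (c + 5) ≤ 4913 * x ^ (c + 4) := by
    have e : ℓ ^ 3 * x ^ (c + 5) = (ℓ * y) ^ 3 * y ^ 13 * x ^ (c + 4) := by
      rw [show c + 5 = (c + 4) + 1 by ring, pow_succ, ← hy16]; ring
    rw [e]
    have h := pow_le_pow_left₀ (by positivity) hℓy 3
    have hy13 : y ^ 13 ≤ 1 := pow_le_one₀ hy0.le hy1
    have hxc : 0 ≤ x ^ (c + 4) := by positivity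
    calc (ℓ * y) ^ 3 * y ^ 13 * x ^ (c + 4) ≤ 17 ^ 3 * 1 * x ^ (c + 4) := by gcongr
      _ = 4913 * x ^ (c + 4) := by norm_num
  -- per colour component α: SD identity, Hessian bound, arithmetic
  have hIY : ∀ α : Fin 3, ∫ U, (actionDeriv (fundamentalRep (Fin 2)) (u α) (GaugeField.gaugeAct (axialGauge U lo hi) U)) ^ 2 ∂(gibbsK F ℰp γ K)
      ≤ KH * (x * (F.L : ℝ) ^ j) := by
    intro α
    have hS0 : 0 ≤ ∑ b : PBond (F.P K) 0, ‖u α b‖ ^ 2 := by positivity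
    have hD0 : 0 ≤ ∑ p : Plaq (F.P K) 0, ‖u α (slotBond p 0) + u α (slotBond p 1) - u α (slotBond p 2) - u α (slotBond p 3)‖ ^ 2 := by
      positivity
    -- second-order Schwinger–Dyson: `∫ Y² = x · ∫ Hess`
    have hSD : ∫ U, (actionDeriv (fundamentalRep (Fin 2)) (u α) (GaugeField.gaugeAct (axialGauge U lo hi) U)) ^ 2 ∂(gibbsK F ℰp γ K) =
        x * ∫ U, actionDeriv₂ (fundamentalRep (Fin 2)) (u α) (GaugeField.gaugeAct (axialGauge U lo hi) U) ∂(gibbsK F ℰp γ K) := by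
      have h := h2 F γ hγ.le K lo hi n (u α) hbox hn (hsu α) (hsupp α)
      rw [hβ] at h
      have h' := congrArg (fun t : ℝ => x * t) h
      simpa only [← mul_assoc, mul_inv_cancel₀ hX0.ne', one_mul] using h'
    -- Hessian on/off the event at `θ = θ_K`
    have hH := H3 F γ hγ.le K lo hi n (u α) hbox hn (hsu α) (hsupp α) (x ^ ((3 : ℝ) / 8)) hT0
    -- (T2) small-field corrections: `(n+1)²(θ+θ²)Σ‖u‖² ≤ 578·C₁(C₁+1)²·L^j`
    have hT2 : ((n : ℝ) + 1) ^ 2 * (x ^ ((3 : ℝ) / 8) + (x ^ ((3 : ℝ) / 8)) ^ 2) * ∑ b : PBond (F.P K) 0, ‖u α b‖ ^ 2 ≤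
        578 * C₁ * (C₁ + 1) ^ 2 * (F.L : ℝ) ^ j := by
      have hθθ : x ^ ((3 : ℝ) / 8) + (x ^ ((3 : ℝ) / 8)) ^ 2 ≤ 2 * x ^ ((3 : ℝ) / 8) := by
        have h := mul_le_mul_of_nonneg_left hT1 hT0.le
        rw [mul_one, ← pow_two] at h; linarith
      calc ((n : ℝ) + 1) ^ 2 * (x ^ ((3 : ℝ) / 8) + (x ^ ((3 : ℝ) / 8)) ^ 2) * ∑ b : PBond (F.P K) 0, ‖u α b‖ ^ 2
          ≤ ((C₁ + 1) * (F.L : ℝ) ^ (c * j) * ℓ) ^ 2 * (2 * x ^ ((3 : ℝ) / 8)) * (C₁ * (F.L : ℝ) ^ (c * j)) := by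
            gcongr
            · exact hS α
      _ = 2 * C₁ * (C₁ + 1) ^ 2 * (F.L : ℝ) ^ (3 * (c * j)) * (ℓ ^ 2 * x ^ ((3 : ℝ) / 8)) := by
            have hp : (F.L : ℝ) ^ (3 * (c * j)) = (F.L : ℝ) ^ (c * j) * (F.L : ℝ) ^ (c * j) * (F.L : ℝ) ^ (c * j) := by
              rw [← pow_add, ← pow_add]; congr 1; ring
            rw [hp]; ring
      _ ≤ 2 * C₁ * (C₁ + 1) ^ 2 * (F.L : ℝ) ^ (3 * (c * j)) * (289 * y ^ 4) := by gcongr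
      _ = 578 * C₁ * (C₁ + 1) ^ 2 * ((F.L : ℝ) ^ (3 * (c * j)) * y ^ 4) := by ring
      _ ≤ 578 * C₁ * (C₁ + 1) ^ 2 * 1 := by gcongr
      _ ≤ 578 * C₁ * (C₁ + 1) ^ 2 * (F.L : ℝ) ^ j := by gcongr
    -- (T3) Hessian × tail: `Σ‖u‖²·tail ≤ 4913·C₁C₄(C₁+1)³·L^j`
    have hT3 : (∑ b : PBond (F.P K) 0, ‖u α b‖ ^ 2) * (gibbsK F ℰp γ K).real {U | ¬ PlaqSmallOn (boxPlaqs lo hi) (x ^ ((3 : ℝ) / 8)) U} ≤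
        4913 * C₁ * C₄ * (C₁ + 1) ^ 3 * (F.L : ℝ) ^ j := by
      calc (∑ b : PBond (F.P K) 0, ‖u α b‖ ^ 2) * (gibbsK F ℰp γ K).real {U | ¬ PlaqSmallOn (boxPlaqs lo hi) (x ^ ((3 : ℝ) / 8)) U}
          ≤ (C₁ * (F.L : ℝ) ^ (c * j)) * (C₄ * ((n : ℝ) + 1) ^ 3 * x ^ (c + 5)) := mul_le_mul (hS α) hm hm0 (by positivity)
        _ ≤ (C₁ * (F.L : ℝ) ^ (c * j)) * (C₄ * ((C₁ + 1) * (F.L : ℝ) ^ (c * j) * ℓ) ^ 3 * x ^ (c + 5)) := by gcongr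
        _ = C₁ * C₄ * (C₁ + 1) ^ 3 * (F.L : ℝ) ^ (4 * (c * j)) * (ℓ ^ 3 * x ^ (c + 5)) := by
            have hp : (F.L : ℝ) ^ (4 * (c * j)) = (F.L : ℝ) ^ (c * j) * ((F.L : ℝ) ^ (c * j)) ^ 3 := by
              rw [← pow_mul, ← pow_add]; congr 1; ring
            rw [hp]; ring
        _ ≤ C₁ * C₄ * (C₁ + 1) ^ 3 * (F.L : ℝ) ^ (4 * (c * j)) * (4913 * x ^ (c + 4)) := by gcongr
        _ = 4913 * C₁ * C₄ * (C₁ + 1) ^ 3 * x * ((F.L : ℝ) ^ (4 * (c * j)) * x ^ (c + 3)) := by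
            rw [show c + 4 = (c + 3) + 1 by ring, pow_succ]; ring
        _ ≤ 4913 * C₁ * C₄ * (C₁ + 1) ^ 3 * x * 1 := by gcongr
        _ ≤ 4913 * C₁ * C₄ * (C₁ + 1) ^ 3 * 1 * 1 := by gcongr
        _ ≤ 4913 * C₁ * C₄ * (C₁ + 1) ^ 3 * (F.L : ℝ) ^ j := by rw [mul_one, mul_one]; exact le_mul_of_one_le_right (by positivity) hLj1
    have hIH : ∫ U, actionDeriv₂ (fundamentalRep (Fin 2)) (u α) (GaugeField.gaugeAct (axialGauge U lo hi) U) ∂(gibbsK F ℰp γ K) ≤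
        KH * (F.L : ℝ) ^ j := by
      have e1 := mul_le_mul_of_nonneg_left (hD α) hC₃
      have e2 := mul_le_mul_of_nonneg_left hT2 hC₃
      have e3 := mul_le_mul_of_nonneg_left hT3 hC₃
      rw [hKH]
      nlinarith [hH, e1, e2, e3]
    rw [hSD]
    calc x * (∫ U, actionDeriv₂ (fundamentalRep (Fin 2)) (u α) (GaugeField.gaugeAct (axialGauge U lo hi) U) ∂(gibbsK F ℰp γ K))
        ≤ x * (KH * (F.L : ℝ) ^ j) := mul_le_mul_of_nonneg_left hIH hX0.le
      _ = KH * (x * (F.L : ℝ) ^ j) := by ring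
  -- sum over the three colour components
  have hsum : ∑ α : Fin 3, ∫ U, (actionDeriv (fundamentalRep (Fin 2)) (u α) (GaugeField.gaugeAct (axialGauge U lo hi) U)) ^ 2 ∂(gibbsK F ℰp γ K)
      ≤ 3 * (KH * (x * (F.L : ℝ) ^ j)) := by
    calc ∑ α : Fin 3, ∫ U, (actionDeriv (fundamentalRep (Fin 2)) (u α) (GaugeField.gaugeAct (axialGauge U lo hi) U)) ^ 2 ∂(gibbsK F ℰp γ K)
        ≤ ∑ α : Fin 3, KH * (x * (F.L : ℝ) ^ j) := Finset.sum_le_sum fun α _ => hIY α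
      _ = 3 * (KH * (x * (F.L : ℝ) ^ j)) := by
          simp only [Finset.sum_const, Finset.card_univ, Fintype.card_fin, nsmul_eq_mul, Nat.cast_ofNat]
  -- (T6) the weighted thin-rectangle row: `Σ_b ω_b·∫dist₁((VU) b)² ≤ C₅·C₁·(x·L^j)` by the folded floor
  have hT6 : ∑ b : PBond (F.P K) 0, ω b * ∫ U, (GaugeGroup.dist1 (GaugeField.gaugeAct (axialGauge U lo hi) U b)) ^ 2 ∂(gibbsK F ℰp γ K) ≤
      C₅ * C₁ * (x * (F.L : ℝ) ^ j) := by
    have hterm : ∀ b : PBond (F.P K) 0, ω b * ∫ U, (GaugeGroup.dist1 (GaugeField.gaugeAct (axialGauge U lo hi) U b)) ^ 2 ∂(gibbsK F ℰp γ K) ≤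
        ω b * (C₅ * n * ℓ * x) := by
      intro b
      by_cases hb : ω b = 0
      · rw [hb, zero_mul, zero_mul]
      · rw [hℓ, mul_one]; exact mul_le_mul_of_nonneg_left (H5 F γ rfl hγ hγc' K lo hi n hbox hn6 b (hωsupp b hb)) (hω0 b)
    calc ∑ b : PBond (F.P K) 0, ω b * ∫ U, (GaugeGroup.dist1 (GaugeField.gaugeAct (axialGauge U lo hi) U b)) ^ 2 ∂(gibbsK F ℰp γ K)
        ≤ ∑ b : PBond (F.P K) 0, ω b * (C₅ * n * ℓ * x) := Finset.sum_le_sum fun b _ => hterm b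
      _ = C₅ * x * ((n : ℝ) * ℓ * ∑ b : PBond (F.P K) 0, ω b) := by rw [← Finset.sum_mul]; ring
      _ ≤ C₅ * x * (C₁ * (F.L : ℝ) ^ j) := mul_le_mul_of_nonneg_left (by rw [hℓ, mul_one]; exact hfloor) (by positivity)
      _ = C₅ * C₁ * (x * (F.L : ℝ) ^ j) := by ring
  -- (T5) the bare tail term
  have hT5 : 4 * (gibbsK F ℰp γ K).real {U | ¬ PlaqSmallOn (boxPlaqs lo hi) (x ^ ((3 : ℝ) / 8)) U} ≤
      4 * (4913 * C₄ * (C₁ + 1) ^ 3) * (x * (F.L : ℝ) ^ j) := by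
    calc 4 * (gibbsK F ℰp γ K).real {U | ¬ PlaqSmallOn (boxPlaqs lo hi) (x ^ ((3 : ℝ) / 8)) U}
        ≤ 4 * (C₄ * ((n : ℝ) + 1) ^ 3 * x ^ (c + 5)) := by gcongr
      _ ≤ 4 * (C₄ * ((C₁ + 1) * (F.L : ℝ) ^ (c * j) * ℓ) ^ 3 * x ^ (c + 5)) := by gcongr
      _ = 4 * C₄ * (C₁ + 1) ^ 3 * (F.L : ℝ) ^ (3 * (c * j)) * (ℓ ^ 3 * x ^ (c + 5)) := by rw [pow_mul]; ring
      _ ≤ 4 * C₄ * (C₁ + 1) ^ 3 * (F.L : ℝ) ^ (3 * (c * j)) * (4913 * x ^ (c + 4)) := by gcongr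
      _ = 4 * (4913 * C₄ * (C₁ + 1) ^ 3) * x * ((F.L : ℝ) ^ (3 * (c * j)) * x ^ (c + 3)) := by
          rw [show c + 4 = (c + 3) + 1 by ring, pow_succ]; ring
      _ ≤ 4 * (4913 * C₄ * (C₁ + 1) ^ 3) * x * 1 := by gcongr
      _ ≤ 4 * (4913 * C₄ * (C₁ + 1) ^ 3) * (x * (F.L : ℝ) ^ j) := by
          rw [mul_one]
          exact mul_le_mul_of_nonneg_left (le_mul_of_one_le_right hX0.le hLj1) (by positivity)
  -- assemble
  have hC₁sum := mul_le_mul_of_nonneg_left hsum hC₁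
  rw [horient]
  calc _ ≤ _ := hlin
    _ ≤ C₁ * (3 * (KH * (x * (F.L : ℝ) ^ j))) + C₅ * C₁ * (x * (F.L : ℝ) ^ j) + C₁ * (x * (F.L : ℝ) ^ j) +
          4 * (4913 * C₄ * (C₁ + 1) ^ 3) * (x * (F.L : ℝ) ^ j) := by
        rw [hxLj]; linarith [hC₁sum, hT5, hT6]
    _ = (3 * C₁ * KH + C₅ * C₁ + C₁ + 4 * (4913 * C₄ * (C₁ + 1) ^ 3)) * (γ * ((F.L : ℝ)⁻¹) ^ (K - j)) := by rw [hxLj]; ring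


/-! ## §2 The six landed stubs, BY NAME ⇒ «ShallowFluxSecondMomentL» ⇒ `MeanDeviationShallowL`; `MeanDeviationL` ⟸ the deep half -/

/-- ★★★ **«ShallowFluxSecondMomentL», HYPOTHESIS-FREE**: the UV-window second moment of one block-averaged plaquette,
`∫ dist₁(Ū^j(∂a))² dμ_K ≤ C·γL^{−(K−j)}` for `1 ≤ j`, `N₁·j ≤ K`, from the six landed stubs of LINE 28 by name
(✓p757896 linTest · ✓p751141 condSD ∕ hessOnEvent · ✓p738745 peierls0 · ✓p749481 thinRect ∕ orient). [cite: GrossCMP1983, Thm 2.2] -/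
theorem shallowFluxSecondMomentL :
    ∀ (L : ℕ), ∃ N₁ : ℕ, 0 < N₁ ∧ ∃ C : ℝ, 0 ≤ C ∧ ∃ γ₁ : ℝ, 0 < γ₁ ∧ γ₁ ≤ 1 ∧
          ∀ (F : T3Family) (γ : ℝ), F.L = L → 0 < γ → γ ≤ γ₁ → ∀ (K j : ℕ), 1 ≤ j → N₁ * j ≤ K →
            ∀ a : Plaq (F.P K) j,
              ∫ U, (GaugeGroup.dist1 (GaugeField.plaqHol
                  (Averaging.iter (fun i' => BlockAveraging.blockAvg (P := F.P K) (j := i') ℰp) j U) a)) ^ 2 ∂(gibbsK F ℰp γ K)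
                ≤ C * (γ * ((F.L : ℝ)⁻¹) ^ (K - j)) :=
  shallowFluxSecondMomentL_of
    Summit.QuantumFields.YangMills.Theorems.GrossTransferStubLinTest.stub_linTest
    Summit.QuantumFields.YangMills.Theorems.GrossTransferStubsRestampV33.stub_condSD
    Summit.QuantumFields.YangMills.Theorems.GrossTransferStubsRestampV33.stub_hessOnEvent
    Summit.QuantumFields.YangMills.Theorems.UnitScaleGibbsBoxPeierlsPolynomial.stub_peierls0
    Summit.QuantumFields.YangMills.Theorems.GrossTransferStubsRestampV32.stub_thinRect
    Summit.QuantumFields.YangMills.Theorems.GrossTransferStubsRestampV32.stub_orient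

/-- ★★★ **`RevelationMartingale.MeanDeviationShallowL` (stmt-QuantumFields-23133) BY NAME, HYPOTHESIS-FREE**: the six landed stubs ⇒ window second
moment ⇒ the shallow first-moment crux (✓p733394 `meanDeviationShallowL_of_shallowSecondMoment`: AM–GM and the room lemma `C·g² ≤ θBal²∕256`).
[cite: Balaban1985UV3, (7) p.257] -/
theorem meanDeviationShallowL :
    Summit.QuantumFields.YangMills.Theses.RevelationMartingale.MeanDeviationShallowL :=
  meanDeviationShallowL_of_shallowSecondMoment shallowFluxSecondMomentL

/-- ★★ **`RevelationMartingale.MeanDeviationL` (stmt-QuantumFields-23083) ⟸ ITS DEEP HALF ALONE**: with the window second moment in the tree, the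
parent first-moment crux follows from `MeanDeviationDeepL` (stmt-QuantumFields-23134 = LINE 28's registered residual `stub_meanDeviationDeep`) by
✓`meanDeviationL_of_shallowSecondMoment_deep`.  A DOOR: `hDeep` is OPEN. [cite: Balaban1985UV3, (7) p.257 and (71) p.273] -/
theorem meanDeviationL_of_deep
    (hDeep : Summit.QuantumFields.YangMills.Theses.RevelationMartingale.MeanDeviationDeepL) :
    Summit.QuantumFields.YangMills.Theses.RevelationMartingale.MeanDeviationL :=
  meanDeviationL_of_shallowSecondMoment_deep shallowFluxSecondMomentL hDeep

/-- ★★ The same door in the `Theses.PoincareLipschitz` spelling of the shared item stmt-QuantumFields-23083 (route PoincareLipschitz, rank 4).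
[cite: Balaban1985UV3, (7) p.257 and (71) p.273] -/
theorem meanDeviationL'_of_deep
    (hDeep : Summit.QuantumFields.YangMills.Theses.RevelationMartingale.MeanDeviationDeepL) :
    Summit.QuantumFields.YangMills.Theses.PoincareLipschitz.MeanDeviationL :=
  meanDeviationL_of_shallowSecondMoment_deep' shallowFluxSecondMomentL hDeep

end Summit.QuantumFields.YangMills.Theorems.GrossTransferShallowSecondMoment
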